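import Summits.QuantumFields.BalabanUV.T4Continuum.Support.B13StepOfRecordSecantTermwise
import Summits.QuantumFields.BalabanUV.T4Continuum.Support.B13StepEndWitness

/-!
# NE5 ∕ U3 — NON-VACUITY WITNESS for the most-reduced secant END of record (`B13StepOfRecordSecantTermwise`, p213235): leaf-10's
# ZERO slot package satisfies EVERY one of its displayed binders — the END FIRES on Bałaban's carriers of record

Cell `pub-balaban`, unit `b2b-balaban-t4-ne5-formalise-leaf-01` (NE5 formalisation swarm, LEAF PROVER 01, gen 4; journal INTENT
`B13StepOfRecordSecantTermwiseWitness`; a follower of this lineage's `B13StepOfRecordSecantTermwise` p213235 in the pattern of leaf-10's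
`B13StepEndWitness` p211760, whose zero package `zeroSlots` and §2 binder lemmas are consumed BY NAME).  Summits-side bookkeeping
(a CONSISTENCY witness: nothing of [Balaban1988RG2Cluster] is modelled or asserted; NOT NE5 progress).  HONEST FRAMING: rung (B)+1 of the
FINITE-VOLUME T⁴ continuum programme — NOT infinite volume, NOT a mass gap, NOT the Clay problem, NOT a proof of NE5 (spine 0∕9).
HONEST DEPENDENCY (cell line, verbatim): continuum YM on T⁴ ⇐ BetaPertH ∧ nine spine estimates (0/9 proved); BetaPertH ⇐ (D1) ∧ (D4) ∧
CAP+tail; G-an2-4 gates asym, D1 and NE2/3/4.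

WHAT THIS FILE DOES.  `B13StepOfRecordSecantTermwise.ne5_of_record_secant_termwise` carries ≈ 45 displayed binders, several in NEW
currencies (the STRUCTURE `ActExpLinearOn` with exhibited activity data, `ActExpNormBound`, `ActAbsBound`, P2's termwise operator shapes
`ActOpBound` ∕ `ActOpLip`, the two (2.38) SHAPES with the explicit constants `64·log 162 + 64 ≤ Rt`, `36·ε·e^{64}·K₀(64,8) < 1`, the
insertion-operator species data, the radii involving `δ′`).  This file shows they are JOINTLY SATISFIABLE on every pair of runs
`R : B13Carriers.TwoRuns 𝔾`: §1 the zero activity data `zeroActData` (Dirac measure on `Unit`, weight `0`, functional `0`) and the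
per-activity binders at zero (`actExpLinearOn_zero`, `actExpNormBound_zero`, `actAbsBound_zero`, `actOpBound_zero`, `actOpLip_zero`,
`shape238_zero`); §2 **`end_fires_zeroSlots_secant_termwise : 0 ≤ κ → ∃ C₅, NE5 (outA (zeroSlots R) 0 0) (outB (zeroSlots R) 0 0) W κ 1 C₅`**
obtained FROM `ne5_of_record_secant_termwise` BY NAME with every other binder supplied by leaf-10's §2 lemmas and explicit numbers
`(EA₀, E₀, E₁, cA, cB, c₁, r₀, Gi, δI, ρ₁, k₁, θ, θ′, ρ₀, k₀, B, N̄, N̄op, ε, εop) = (0,0,1,0,0,0,1,0,0,0,0,½,1,1,0,0,0,0,0,0)`, `ω = ½`,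
`Rt = 64·log 162 + 64`, `ROp ≡ RHist ≡ 1`.  No hidden sign ∕ shape clash.  0 sorry; axioms ⊆ {propext, Classical.choice, Quot.sound}.
-/

noncomputable section

open MeasureTheory Metric Set
open scoped BigOperators

namespace Summit.QuantumFields.BalabanUV.T4Continuum.B13StepOfRecordSecantTermwiseWitness

open Literature.MathematicalPhysics.QuantumFieldTheory.Balaban1983to89
open Literature.MathematicalPhysics.QuantumFieldTheory.Balaban1983to89.T4OutputRate (NE5)
open Literature.MathematicalPhysics.QuantumFieldTheory.Balaban1983to89.T4InputCauchyRateSpecies (ballClass)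
open Summit.QuantumFields.BalabanUV.T4Continuum.B13Carriers (TwoRuns)
open Summit.QuantumFields.BalabanUV.T4Continuum.B13OpDatum (OpDatum)
open Summit.QuantumFields.BalabanUV.T4Continuum.B13StepTermLabels (InnerLabel)
open Summit.QuantumFields.BalabanUV.T4Continuum.B13StepTermFamily (ActData ActExpLinearOn)
open Summit.QuantumFields.BalabanUV.T4Continuum.B13StepTermSocket (labelsIndexing touchInc)
open Summit.QuantumFields.BalabanUV.T4Continuum.B13InnerData (Bnd b13InnerData)
open Summit.QuantumFields.BalabanUV.T4Continuum.B13Base (selfCtr)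
open Summit.QuantumFields.BalabanUV.T4Continuum.B13Represents (Assembly)
open Summit.QuantumFields.BalabanUV.T4Continuum.B13TermHistSecant (ActExpNormBound ActAbsBound)
open Summit.QuantumFields.BalabanUV.T4Continuum.B13TermOpSecant (ActOpBound ActOpLip)
open Summit.QuantumFields.BalabanUV.T4Continuum.B13DomainGeometryTR (domainGeometry)
open Summit.QuantumFields.BalabanUV.T4Continuum.B13StepOfRecord (Slots assembly step outA outB)
open Summit.QuantumFields.BalabanUV.T4Continuum.UrsellTermBudget (actSum)
open Summit.QuantumFields.BalabanUV.T4Continuum.B13StepEndWitness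
open Summit.QuantumFields.BalabanUV.T4Continuum.B13StepOfRecordSecantTermwise (ne5_of_record_secant_termwise)

variable {𝔾 : Type} [GaugeGroup 𝔾] (R : TwoRuns 𝔾)

/-! ## §1 The zero activity data and the per-activity binders at zero -/

/-- [folklore] DATA: the ZERO activity data for the zero package — at every polymer ∕ label ∕ operator point the Dirac measure on `Unit`,
the weight `0` and the linear history functional `0`. -/
def zeroActData : ActData R.carriers.Dom (InnerLabel R.carriers.Dom (Bnd R)) (OpDatum Unit) ℂ Unit where
  ν := fun _ _ _ => Measure.dirac ()
  Φ := fun _ _ _ _ => 0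
  Λ := fun _ _ _ _ => 0

/-- [folklore] STRUCTURE: the zero activity terms of `zeroSlots R` are exp-linear with the zero data on ANY class (`0 = ∫ 0·e^{0·h} dδ`). -/
theorem actExpLinearOn_zero (K : ℕ → (ℕ → ℝ) → R.carriers.BgB → Set (OpDatum Unit × ℂ)) (W : Set (ℕ → ℝ)) :
    ActExpLinearOn (labelsIndexing (domainGeometry R) (b13InnerData R)) (zeroSlots R).act (zeroActData R) K W where
  sigmaFinite := fun _ _ _ _ _ _ _ _ _ _ _ => by
    show SigmaFinite (Measure.dirac ())
    infer_instance
  integrable := fun _ _ _ _ _ _ _ _ _ _ _ => integrable_zero _ _ _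
  measurable := fun _ _ _ _ _ _ _ _ _ _ _ _ => aestronglyMeasurable_const
  bounded := fun _ _ _ _ _ _ _ _ _ _ _ => ⟨0, Filter.Eventually.of_forall fun _ => by simp [zeroActData]⟩
  repr := fun _ _ _ _ _ _ _ _ _ _ _ => by simp [zeroActData, zeroSlots]

/-- [folklore] Exponent bounds with `N ≡ 0` in any units `r`. -/
theorem actExpNormBound_zero (K : ℕ → (ℕ → ℝ) → R.carriers.BgB → Set (OpDatum Unit × ℂ)) (W : Set (ℕ → ℝ)) (r : ℕ → ℝ) :
    ActExpNormBound (labelsIndexing (domainGeometry R) (b13InnerData R)) (zeroActData R) K W r fun _ _ _ _ _ => 0 :=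
  fun _ _ _ _ _ _ _ _ _ _ _ => Filter.Eventually.of_forall fun _ => by simp [zeroActData]

/-- [folklore] Absolute majorants with `A ≡ 0`. -/
theorem actAbsBound_zero (K : ℕ → (ℕ → ℝ) → R.carriers.BgB → Set (OpDatum Unit × ℂ)) (W : Set (ℕ → ℝ)) :
    ActAbsBound (labelsIndexing (domainGeometry R) (b13InnerData R)) (zeroActData R) K W fun _ _ _ _ _ => 0 :=
  fun _ _ _ _ _ _ _ _ _ _ _ => by simp [zeroActData]

variable (E₀ cB : ℝ) (W : Set (ℕ → ℝ))

/-- [folklore] P2's termwise operator bound with `Aop ≡ 0` for the zero terms. -/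
theorem actOpBound_zero (ρ₀ : ℝ) :
    ActOpBound (labelsIndexing (domainGeometry R) (b13InnerData R)) (zeroSlots R).act (step (zeroSlots R) E₀ cB) W ρ₀
      fun _ _ _ _ _ => 0 :=
  fun _ _ _ _ _ _ _ _ _ _ _ _ _ => by simp [zeroSlots]

/-- [folklore] P2's termwise relative operator modulus with `Nop ≡ 0`, `Aop ≡ 0` for the zero terms. -/
theorem actOpLip_zero (ρ₀ : ℝ) :
    ActOpLip (labelsIndexing (domainGeometry R) (b13InnerData R)) (zeroSlots R).act (step (zeroSlots R) E₀ cB) W ρ₀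
      (fun _ _ _ _ _ => 0) fun _ _ _ _ _ => 0 :=
  fun _ _ _ _ _ _ _ _ _ _ _ _ _ => by simp [zeroSlots]

/-- [folklore] The (2.38) SHAPE with `ε = 0` for the zero majorant (`actSum` of `0` is `0`). -/
theorem shape238_zero (Rt : ℝ) :
    ∀ k, ∀ g ∈ W, ∀ (U : R.carriers.BgB), ∀ Z ∈ R.domAt k,
      actSum (b13InnerData R) ((fun _ _ _ _ _ => (0 : ℝ)) k g U) k Z ≤ 0 * Real.exp (-(Rt * R.carriers.d Z)) := by
  intro k g _ U Z _
  simp [actSum]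

/-! ## §2 The END fires for the zero package -/

/-- [folklore] **NON-VACUITY OF THE MOST-REDUCED SECANT END ON BAŁABAN's CARRIERS OF RECORD.**  For EVERY pair of runs `R`, window
`W` and rate `κ ≥ 0` the zero slot package satisfies EVERY hypothesis of `B13StepOfRecordSecantTermwise.ne5_of_record_secant_termwise`
— reading, slice budgets, levels, W1 entry data, the insertion species (leaf-10's §2 lemmas BY NAME), the STRUCTURE with `zeroActData`,
exponent bounds ∕ majorants ∕ operator shapes at `0`, both (2.38) shapes at `ε = 0` with rate room `Rt = 64·log 162 + 64`, radii
`ROp ≡ RHist ≡ 1`, numbers `(E₁, r₀, θ, θ′, ρ₀, ω) = (1, 1, ½, 1, 1, ½)`, all other letters `0` — so the END FIRES: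
`∃ C₅, NE5 (outA (zeroSlots R) 0 0) (outB (zeroSlots R) 0 0) W κ 1 C₅`.  The binder list is therefore JOINTLY SATISFIABLE. -/
theorem end_fires_zeroSlots_secant_termwise {κ : ℝ} (hκ : 0 ≤ κ) :
    ∃ C₅, NE5 (outA (zeroSlots R) 0 0) (outB (zeroSlots R) 0 0) W κ 1 C₅ :=
  ⟨_, ne5_of_record_secant_termwise (zeroSlots R) 0 0 (ROp := fun _ => 1) (RHist := fun _ => 1)
    (N := fun _ _ _ _ _ => 0) (A := fun _ _ _ _ _ => 0) (A' := fun _ _ _ _ _ => 0) (Nop := fun _ _ _ _ _ => 0)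
    (Aop := fun _ _ _ _ _ => 0) (Aop' := fun _ _ _ _ _ => 0) (Dt := zeroActData R) (Nbar := 0) (Nopbar := 0) (ε := 0) (εop := 0)
    (Rt := 64 * Real.log 162 + 64) (EA₀ := 0) (E₁ := 1) (cA := 0) (c₁ := 0) (r₀ := 1) (Gi := 0) (δI := 0) (ρ₁ := 0) (θ := 1 / 2)
    (θ' := 1) (ρ₀ := 1) (B := 0) (k₀ := 0) (k₁ := 0) (fun _ => 1) (fun _ => one_pos)
    (transportReads_zero R W) (sliceBudgetB_zero R W κ) (sliceBudget_zero R 0 0 W κ) (decayBound_outA_zero R 0 0 W κ)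
    (decayBound_outB_zero R 0 0 W κ) (rawBounded_rawAt_zero R W) (rawBounded_rawB_zero R W)
    (weightedEntrywiseRate_zero R W fun k => (1 / 2 : ℝ) ^ k) (floor_zero R) (insOpEnvelope_zero R 0 0 W κ)
    (insBoundA_zero R 0 0 W κ) (insOpRate_zero R 0 0 W (1 / 2)) le_rfl le_rfl zero_lt_one (by norm_num)
    (actOpBound_zero R 0 0 W 1) (actOpLip_zero R 0 0 W 1) (fun _ _ _ _ _ => le_rfl) (fun _ _ _ _ _ => le_rfl) le_rfl
    (fun _ _ _ _ _ => le_rfl) (fun _ _ _ _ _ => le_rfl) (fun _ _ _ _ _ => by simp) le_rfl (shape238_zero R W _) (by norm_num)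
    (actExpLinearOn_zero R _ W) (actExpNormBound_zero R _ W _) (fun _ _ _ _ _ => le_rfl) (fun _ _ _ _ _ => le_rfl) le_rfl
    (actAbsBound_zero R _ W) (fun _ _ _ _ _ => le_rfl) (fun _ _ _ _ _ => le_rfl) hκ (fun _ _ _ _ _ => by simp) le_rfl
    (shape238_zero R W _) le_rfl (by norm_num)
    (fun _ => by show (0 : ℝ) / 1 * 1 ≤ 1; norm_num)
    (fun k => by simp [Assembly.bHist])
    (fun _ => by rw [omega_zero]; show (0 * 0 / (1 - 0) + 2 * 0 / (1 / 2 : ℝ) ^ 0) * 1 + 0 * (1 * (0 / (1 - 1 / 2))) ≤ 1; norm_num)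
    le_rfl le_rfl one_pos le_rfl le_rfl le_rfl one_pos (by norm_num) (by norm_num) le_rfl (by rw [omega_zero]; norm_num)
    (by rw [omega_zero]; norm_num) zero_le_one (by norm_num) le_rfl (fun k hk => absurd hk (Nat.not_lt_zero k))
    (by rw [omega_zero]; norm_num)⟩

end Summit.QuantumFields.BalabanUV.T4Continuum.B13StepOfRecordSecantTermwiseWitness

end
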